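import Literature.Computability.QuantumComplexity.OracleCoinFn
import Literature.Computability.QuantumComplexity.OracleClassicalProgs
import Literature.Computability.QuantumComplexity.CoinFamilyKernel
import Literature.Computability.QuantumComplexity.RevMultiplex
import Literature.Computability.QuantumComplexity.PhaseQueryLayout
import HarnessLib

/-!
# Uniform oracle coin simulation, II: parameters, layout, the program and the coin family

Second file of the `OCoin` discharge of `uniformOracleCoinSimulation` (`CoinFamilyKernel.lean`;
plan in `OracleCoinFn.lean`). Syntax and bounds only.

**Parameters** (`Params`): the coin polynomial `q`, the oracle algorithm `M` (transcript model of
`Oracle.lean`) with its round/query-length polynomial `r` (as in the clauses of `FPRel`), and a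
machine `Mtm` with time exponent `e` computing the block function `simFn M r q` of
`OracleCoinFn.lean` (`RevClean.exists_outputsWithin_pow_of_mem_FP`).

**Layout** at input length `n` (all wires in `ℕ`; `R = r(2n + 2 + q(n))` is both the number of
rounds and the bound on the query length): the input `x` on `[0, n)`, the coins `y` on
`[n, n + q(n))` (where `coinFamily` puts its Hadamard gates), the `R (R+1)` *answer slots*
`slotW s ℓ` — these `DD n` wires are the data of the one garbage-free block `blk`
(`RevClean.cleanOps` with the suffix `CWrap.vg n`, occupying `[0, Wblk)`, its `true`-code result
wire of output cell `k` being `fW k`); above the block the `R` *query windows* `winW t i`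
(`t, i < R`). **Program** (`body`, an `RtOp ℕ` program of classical operations and oracle
queries, compiled by `RtOp.compileList` after re-indexing to `Fin`): for every round `t < R`,
`roundOps t` = block, copy of query field `t` of the block's word into window `t`
(`RevClean.copyOps`), block again (erasing the word, `RevClean.clEval_cleanOps_cleanOps`), and the
`R + 1` oracle queries of round `t` — the query of length `ℓ ≤ R` reads the first `ℓ` wires of
window `t` and XORs the oracle's answer into slot `(t, ℓ)`; then a last block and the swap of the
output cells `R², R² + 1, …` of the word with the front wires `0, 1, …, JF - 1`. The classical
part `Dc n` of the coin family `family = coinFamily q mW Dc` is the compilation of `body`; the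
Hadamard layer of `coinFamily` is described by `hadOps` (`OracleCoinUniform.lean`).
(Bernstein–Vazirani 1997, Thm. 8.3 with §8.3: the reversible deterministic computation run on
`|x⟩|y⟩`, its queries presented to the oracle on designated wires.)

## References

* E. Bernstein, U. Vazirani, *Quantum complexity theory*, SIAM J. Comput. 26 (1997) 1411–1473,
  Thm. 8.3 (proof) and §8.3 (oracle QTMs) [BernsteinVazirani1997SICOMP].
* C. H. Bennett, E. Bernstein, G. Brassard, U. Vazirani, *Strengths and weaknesses of quantum
  computing*, SIAM J. Comput. 26 (1997) 1510–1523, §2 (arXiv p. 4) [BennettBernsteinBrassardVazirani1997].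
* M. A. Nielsen, I. L. Chuang, *Quantum Computation and Quantum Information*, CUP 2010, §3.2.5
  (uncomputation), §6.1.1 (the XOR query) [NielsenChuang2010].
-/

noncomputable section

namespace Literature.Computability.QuantumComplexity

namespace OCoin

open _root_.Computability Complexity Cryptography RevSim RevClean RazTalMachine Matrix Turing

/-! ### Parameters -/

/-- **Parameters of the simulation**: coin polynomial `q`, oracle algorithm `M` with round and
query-length polynomial `r`, and a machine `Mtm` computing the block function `simFn M r q` within
`(n+2)^e` steps. [cite: BernsteinVazirani1997SICOMP, Thm. 8.3 (proof) with §8.3] -/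
structure Params where
  /-- the coin polynomial -/
  q : Polynomial ℕ
  /-- the round / query-length polynomial of the oracle algorithm (in the length of `⟨x, y⟩`) -/
  r : Polynomial ℕ
  /-- the oracle algorithm -/
  M : OracleAlg (List Bool)
  /-- time exponent of the block machine -/
  e : ℕ
  /-- the block machine -/
  Mtm : TM2ComputableAux Bool Bool
  /-- it computes the block function within `(n+2)^e` steps -/
  hM : ∀ u, Mtm.OutputsWithin u (simFn M r q u) (Tn e u.length)

variable (P : Params)

/-! ### Layout -/

section Layout

variable (n : ℕ)

/-- The number of coins `q(n)`. [folklore] -/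
abbrev qn : ℕ := P.q.eval n
/-- The length `2n + 2 + q(n)` of the pairing `⟨x, y⟩` on which `M` is run. [folklore] -/
def nx : ℕ := 2 * n + 2 + qn P n
/-- The number of rounds, also the bound on the query length: `R = r(|⟨x, y⟩|)`. [folklore] -/
def RR : ℕ := P.r.eval (nx P n)
/-- The number of answer slots `R (R + 1)` (slot `(s, ℓ)`, `s < R`, `ℓ ≤ R`). [folklore] -/
def SS : ℕ := RR P n * (RR P n + 1)
/-- The number of data wires of the block: input, coins, slots. [folklore] -/
def DD : ℕ := n + qn P n + SS P n
/-- The tableau input length of the block (data plus the suffix `vg n`). [folklore] -/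
def nT : ℕ := DD P n + (CWrap.vg n).length
/-- The width of the block. [folklore] -/
def Wblk : ℕ := width P.e P.Mtm (nT P n)
/-- Wire `i` of query window `t` (above the block). [folklore] -/
def winW (t i : ℕ) : ℕ := Wblk P n + t * RR P n + i
/-- The answer slot `(s, ℓ)`. [folklore] -/
def slotW (s ℓ : ℕ) : ℕ := n + qn P n + s * (RR P n + 1) + ℓ
/-- The `true`-code result wire of output cell `k` of the block. [folklore] -/
def fW (k : ℕ) : ℕ := resW P.e P.Mtm (nT P n) k (CWrap.symTrue P.Mtm)
/-- The width of the front window receiving the output: the number `JJ - R²` of output cells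
from cell `R²` on, written without subtraction (`sq_add_JF`). [folklore] -/
def JF : ℕ := n + qn P n + RR P n + (2 * n + 2) + dd P.Mtm.tm * Tn P.e (nT P n) + 3 * dd P.Mtm.tm
/-- The number of work wires: slots, block work wires, windows. [folklore] -/
def mW : ℕ := SS P n + (Wblk P n - DD P n) + RR P n * RR P n
/-- The number of wires of the circuit, in the form `n + (q(n) + mW n)` of `coinFamily`. [folklore] -/
abbrev NW : ℕ := n + (qn P n + mW P n)

/-- `|vg n| = 2n + 2`, so `nT = DD + 2n + 2`. [folklore] -/
theorem nT_eq : nT P n = DD P n + (2 * n + 2) := by simp [nT]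

/-- `DD ≤ nT`. [folklore] -/
theorem DD_le_nT : DD P n ≤ nT P n := Nat.le_add_right _ _

/-- `nT ≤ NN`. [folklore] -/
theorem nT_le_NN : nT P n ≤ NN P.e P.Mtm (nT P n) := le_NN _

/-- `NN ≤ Wblk`. [folklore] -/
theorem NN_le_Wblk : NN P.e P.Mtm (nT P n) ≤ Wblk P n := NN_le_width _

/-- `DD ≤ Wblk`. [folklore] -/
theorem DD_le_Wblk : DD P n ≤ Wblk P n := le_trans (DD_le_nT P n) (le_trans (nT_le_NN P n) (NN_le_Wblk P n))

/-- **`NW = Wblk + R²`.** [folklore] -/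
theorem NW_eq : NW P n = Wblk P n + RR P n * RR P n := by
  have := DD_le_Wblk P n; dsimp only [NW, mW, DD] at this ⊢; omega

/-- `0 < NW`. [folklore] -/
theorem NW_pos : 0 < NW P n := by
  rw [NW_eq]; exact Nat.add_pos_left (lt_of_lt_of_le (NN_pos P.e P.Mtm _) (NN_le_Wblk P n)) _

/-- `Wblk ≤ NW`. [folklore] -/
theorem Wblk_le_NW : Wblk P n ≤ NW P n := by rw [NW_eq]; exact Nat.le_add_right _ _

/-- `n ≤ JJ n`. [folklore] -/
theorem le_JJ (m : ℕ) : m ≤ JJ P.e P.Mtm m := by unfold JJ Sn; omega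

/-- `R² ≤ SS`. [folklore] -/
theorem sq_le_SS : RR P n * RR P n ≤ SS P n := by unfold SS; nlinarith

/-- `SS ≤ DD`. [folklore] -/
theorem SS_le_DD : SS P n ≤ DD P n := by unfold DD; omega

/-- **`R² + JF = JJ`**: the front window receives the cells `R², …, JJ - 1`. [folklore] -/
theorem sq_add_JF : RR P n * RR P n + JF P n = JJ P.e P.Mtm (nT P n) := by
  simp only [JF, JJ, Sn, nT, DD, SS, CWrap.length_vg]; ring

/-- `JF ≤ JJ ≤ NN`. [folklore] -/
theorem JF_le_NN : JF P n ≤ NN P.e P.Mtm (nT P n) :=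
  le_trans (by have := sq_add_JF P n; omega) (CWrap.JJ_le_NN _)

/-- Front wires are below every result wire. [folklore] -/
theorem lt_fW_of_lt_JF {j : ℕ} (hj : j < JF P n) (k : ℕ) : j < fW P n k :=
  lt_of_lt_of_le (lt_of_lt_of_le hj (JF_le_NN P n)) (NN_le_resW _ _ _)

/-- Data wires are below every result wire. [folklore] -/
theorem lt_fW_of_lt_DD {i : ℕ} (hi : i < DD P n) (k : ℕ) : i < fW P n k :=
  lt_of_lt_of_le (lt_of_lt_of_le hi (le_trans (DD_le_nT P n) (nT_le_NN P n))) (NN_le_resW _ _ _)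

/-- Data wires are below every result wire (`≤` form). [folklore] -/
theorem DD_le_fW (k : ℕ) : DD P n ≤ fW P n k :=
  le_trans (le_trans (DD_le_nT P n) (nT_le_NN P n)) (NN_le_resW _ _ _)

/-- Result wires of represented cells are inside the block. [folklore] -/
theorem fW_lt_Wblk {k : ℕ} (hk : k < JJ P.e P.Mtm (nT P n)) : fW P n k < Wblk P n := resW_lt_width hk _

/-- The cells of the query fields are represented. [folklore] -/
theorem field_lt_JJ {t i : ℕ} (ht : t < RR P n) (hi : i < RR P n) : t * RR P n + i < JJ P.e P.Mtm (nT P n) := by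
  have h1 : t * RR P n + i < RR P n * RR P n := by nlinarith
  have := sq_add_JF P n; omega

/-- The cells moved to the front are represented. [folklore] -/
theorem out_lt_JJ {j : ℕ} (hj : j < JF P n) : RR P n * RR P n + j < JJ P.e P.Mtm (nT P n) := by
  have := sq_add_JF P n; omega

/-- `fW` is injective. [folklore] -/
theorem fW_inj {k k' : ℕ} (h : fW P n k = fW P n k') : k = k' := (resW_inj h).1

/-- Window wires are at least `Wblk`. [folklore] -/
theorem Wblk_le_winW (t i : ℕ) : Wblk P n ≤ winW P n t i := by unfold winW; omega

/-- Window wires are inside the register. [folklore] -/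
theorem winW_lt_NW {t i : ℕ} (ht : t < RR P n) (hi : i < RR P n) : winW P n t i < NW P n := by
  rw [NW_eq]; unfold winW; nlinarith

/-- `winW` is injective (positions below `R`). [folklore] -/
theorem winW_inj {t i t' i' : ℕ} (hi : i < RR P n) (hi' : i' < RR P n) (h : winW P n t i = winW P n t' i') :
    t = t' ∧ i = i' := by
  unfold winW at h
  have h1 : t * RR P n + i = t' * RR P n + i' := by omega
  have ht : t = t' := by
    rcases lt_trichotomy t t' with hlt | heq | hgt
    · exfalso
      have : (t + 1) * RR P n ≤ t' * RR P n := Nat.mul_le_mul_right _ hlt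
      nlinarith
    · exact heq
    · exfalso
      have : (t' + 1) * RR P n ≤ t * RR P n := Nat.mul_le_mul_right _ hgt
      nlinarith
  subst ht
  exact ⟨rfl, by omega⟩

/-- Slots are data. [folklore] -/
theorem slotW_lt_DD {s ℓ : ℕ} (hs : s < RR P n) (hℓ : ℓ ≤ RR P n) : slotW P n s ℓ < DD P n := by
  unfold slotW DD SS
  have : s * (RR P n + 1) + ℓ < RR P n * (RR P n + 1) := by nlinarith
  omega

/-- Slots are above the input and the coins. [folklore] -/
theorem le_slotW (s ℓ : ℕ) : n + qn P n ≤ slotW P n s ℓ := by unfold slotW; omega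

/-- `slotW` is injective (lengths `≤ R`). [folklore] -/
theorem slotW_inj {s ℓ s' ℓ' : ℕ} (hℓ : ℓ ≤ RR P n) (hℓ' : ℓ' ≤ RR P n) (h : slotW P n s ℓ = slotW P n s' ℓ') :
    s = s' ∧ ℓ = ℓ' := by
  unfold slotW at h
  have h1 : s * (RR P n + 1) + ℓ = s' * (RR P n + 1) + ℓ' := by omega
  have hs : s = s' := by
    rcases lt_trichotomy s s' with hlt | heq | hgt
    · exfalso
      have : (s + 1) * (RR P n + 1) ≤ s' * (RR P n + 1) := Nat.mul_le_mul_right _ hlt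
      nlinarith
    · exact heq
    · exfalso
      have : (s' + 1) * (RR P n + 1) ≤ s * (RR P n + 1) := Nat.mul_le_mul_right _ hgt
      nlinarith
  subst hs
  exact ⟨rfl, by omega⟩

/-- The slot index inside the slot string: slot `(s, ℓ)` is data wire `n + q(n) + (s (R+1) + ℓ)`.
[folklore] -/
theorem slotW_eq (s ℓ : ℕ) : slotW P n s ℓ = n + qn P n + (s * (RR P n + 1) + ℓ) := by unfold slotW; omega

end Layout

/-! ### The program -/

section Program

variable (n : ℕ)

/-- **The block** (classical operations): `RevClean.cleanOps` on the `DD n` data wires with the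
suffix `vg n`. [cite: NielsenChuang2010, §3.2.5] -/
def blkC : List (ClOp ℕ) := cleanOps P.e P.Mtm (DD P n) (CWrap.vg n)

/-- The block as `RtOp`s. [folklore] -/
def blk : List (RtOp ℕ) := (blkC P n).map RtOp.cl

/-- The pairs (result wire of cell `tR + i`, wire `i` of window `t`), `i < R`. [folklore] -/
def copyPairs (t : ℕ) : List (ℕ × ℕ) := (List.range (RR P n)).map fun i => (fW P n (t * RR P n + i), winW P n t i)

/-- **The copy of query field `t` into window `t`** (classical). [cite: NielsenChuang2010, §3.2.5 (FANOUT by CNOT)] -/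
def copyC (t : ℕ) : List (ClOp ℕ) := copyOps (copyPairs P n t)

/-- The first `ℓ` wires of window `t`: the query wires of the query of length `ℓ`. [folklore] -/
def qry (t ℓ : ℕ) : List ℕ := (List.range ℓ).map (winW P n t)

/-- **The oracle queries of round `t`**: for every length `ℓ ≤ R`, the query on the first `ℓ`
wires of window `t` with answer wire the slot `(t, ℓ)`. [cite: BernsteinVazirani1997SICOMP, §8.3 (p. 1455: the query track)] -/
def orcT (t : ℕ) : List (RtOp ℕ) := (List.range (RR P n + 1)).map fun ℓ => RtOp.oracle (qry P n t ℓ) (slotW P n t ℓ)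

/-- **Round `t`**: block, copy, block, queries. [cite: BernsteinVazirani1997SICOMP, Thm. 8.3 (proof) with §8.3] -/
def roundOps (t : ℕ) : List (RtOp ℕ) :=
  blk P n ++ (copyC P n t).map RtOp.cl ++ blk P n ++ orcT P n t

/-- The `R` rounds. [folklore] -/
def rounds : List (RtOp ℕ) := (List.range (RR P n)).flatMap (roundOps P n)

/-- The pairs (front wire `j`, result wire of cell `R² + j`), `j < JF`. [folklore] -/
def swapPairs : List (ℕ × ℕ) := (List.range (JF P n)).map fun j => (j, fW P n (RR P n * RR P n + j))

/-- **The output swaps**: front wire `j` with the result wire of cell `R² + j`, `j < JF`, three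
`CNOT`s each (`RevMux.swapOps`). [cite: NielsenChuang2010, §1.3.4 (Fig. 1.7)] -/
def swapsC : List (ClOp ℕ) := RevMux.swapOps (swapPairs P n)

/-- The finale: a last block writing the word, then the output swaps. [folklore] -/
def fin : List (RtOp ℕ) := blk P n ++ (swapsC P n).map RtOp.cl

/-- **The classical part of the circuit** (as an `RtOp ℕ` program). [cite: BernsteinVazirani1997SICOMP, Thm. 8.3 (proof) with §8.3] -/
def body : List (RtOp ℕ) := rounds P n ++ fin P n

/-- The Hadamard layer of `coinFamily`, as `RtOp`s (used for the description only). [cite: BernsteinVazirani1997SICOMP, Thm. 8.3 (proof: Fourier transform of the coin track)] -/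
def hadOps : List (RtOp ℕ) := (List.range (qn P n)).map fun j => RtOp.had (n + j)

end Program

/-! ### Well-formedness and wire bounds -/

section Bounds

variable (n : ℕ)

/-- Classical operations as `RtOp`s are classical-or-query. [folklore] -/
theorem isCl_map_cl {ops : List (ClOp ℕ)} : ∀ op ∈ ops.map RtOp.cl, OSim.IsCl op := by
  intro op hop
  obtain ⟨op', -, rfl⟩ := List.mem_map.1 hop
  exact OSim.isCl_cl op'

/-- The block is well formed. [folklore] -/
theorem blkC_wf : ∀ op ∈ blkC P n, op.WF := cleanOps_wf

/-- The block stays inside the block width. [folklore] -/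
theorem blkC_lt_Wblk : ∀ op ∈ blkC P n, ∀ w ∈ wiresOf op, w < Wblk P n := by
  intro op hop i hi
  have := cleanOps_lt op hop i hi
  simpa [Wblk, nT] using this

/-- Members of `copyPairs`. [folklore] -/
theorem mem_copyPairs {t : ℕ} {p : ℕ × ℕ} :
    p ∈ copyPairs P n t ↔ ∃ i < RR P n, p = (fW P n (t * RR P n + i), winW P n t i) := by
  simp [copyPairs, eq_comm]

/-- The copy is well formed (source inside the block, target above it). [folklore] -/
theorem copyC_wf {t : ℕ} (ht : t < RR P n) : ∀ op ∈ copyC P n t, op.WF := by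
  refine copyOps_wf fun p hp => ?_
  obtain ⟨i, hi, rfl⟩ := (mem_copyPairs P n).1 hp
  exact Nat.ne_of_lt (lt_of_lt_of_le (fW_lt_Wblk P n (field_lt_JJ P n ht hi)) (Wblk_le_winW P n t i))

/-- The copy stays inside the register. [folklore] -/
theorem copyC_lt {t : ℕ} (ht : t < RR P n) : ∀ op ∈ copyC P n t, ∀ w ∈ wiresOf op, w < NW P n := by
  intro op hop w hw
  obtain ⟨p, hp, rfl⟩ := mem_copyOps.1 hop
  obtain ⟨i, hi, rfl⟩ := (mem_copyPairs P n).1 hp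
  simp only [wiresOf, ClOp.target, ClOp.controls, List.mem_cons, List.not_mem_nil, or_false] at hw
  rcases hw with rfl | rfl
  · exact winW_lt_NW P n ht hi
  · exact lt_of_lt_of_le (fW_lt_Wblk P n (field_lt_JJ P n ht hi)) (Wblk_le_NW P n)

/-- The query wires listed. [folklore] -/
@[simp] theorem length_qry (t ℓ : ℕ) : (qry P n t ℓ).length = ℓ := by simp [qry]

/-- Members of the query wires. [folklore] -/
theorem mem_qry {t ℓ w : ℕ} : w ∈ qry P n t ℓ ↔ ∃ i < ℓ, w = winW P n t i := by simp [qry, eq_comm]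

/-- The queries of a round are well formed: distinct query wires, the slot apart. [folklore] -/
theorem orcT_wf {t : ℕ} (ht : t < RR P n) : ∀ op ∈ orcT P n t, op.WF := by
  intro op hop
  simp only [orcT, List.mem_map, List.mem_range] at hop
  obtain ⟨ℓ, hℓ, rfl⟩ := hop
  change (qry P n t ℓ ++ [slotW P n t ℓ]).Nodup
  rw [List.nodup_append]
  refine ⟨?_, List.nodup_singleton _, ?_⟩
  · rw [qry]
    refine (List.nodup_range.map_on fun i hi j hj h => ?_)
    exact (winW_inj P n (lt_of_lt_of_le (List.mem_range.1 hi) (by omega)) (lt_of_lt_of_le (List.mem_range.1 hj) (by omega)) h).2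
  · intro w hw s hs
    rw [List.mem_singleton] at hs
    subst hs
    obtain ⟨i, hi, rfl⟩ := (mem_qry P n).1 hw
    exact Nat.ne_of_gt (lt_of_lt_of_le (lt_of_lt_of_le (slotW_lt_DD P n ht (by omega)) (DD_le_Wblk P n)) (Wblk_le_winW P n t i))

/-- The queries stay inside the register. [folklore] -/
theorem orcT_lt {t : ℕ} (ht : t < RR P n) : ∀ op ∈ orcT P n t, ∀ w ∈ op.wires, w < NW P n := by
  intro op hop w hw
  simp only [orcT, List.mem_map, List.mem_range] at hop
  obtain ⟨ℓ, hℓ, rfl⟩ := hop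
  simp only [RtOp.wires, List.mem_append, List.mem_singleton] at hw
  rcases hw with hw | rfl
  · obtain ⟨i, hi, rfl⟩ := (mem_qry P n).1 hw
    exact winW_lt_NW P n ht (by omega)
  · exact lt_of_lt_of_le (slotW_lt_DD P n ht (by omega)) (le_trans (DD_le_Wblk P n) (Wblk_le_NW P n))

/-- The queries are classical-or-query. [folklore] -/
theorem isCl_orcT (t : ℕ) : ∀ op ∈ orcT P n t, OSim.IsCl op := by
  intro op hop
  simp only [orcT, List.mem_map, List.mem_range] at hop
  obtain ⟨ℓ, -, rfl⟩ := hop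
  exact OSim.isCl_oracle _ _

/-- A round is well formed. [folklore] -/
theorem roundOps_wf {t : ℕ} (ht : t < RR P n) : ∀ op ∈ roundOps P n t, op.WF := by
  intro op hop
  simp only [roundOps, blk, List.mem_append] at hop
  rcases hop with ((h | h) | h) | h
  · exact PhaseQuery.wf_map_cl (blkC_wf P n) op h
  · exact PhaseQuery.wf_map_cl (copyC_wf P n ht) op h
  · exact PhaseQuery.wf_map_cl (blkC_wf P n) op h
  · exact orcT_wf P n ht op h

/-- A round stays inside the register. [folklore] -/
theorem roundOps_lt {t : ℕ} (ht : t < RR P n) : ∀ op ∈ roundOps P n t, ∀ w ∈ op.wires, w < NW P n := by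
  intro op hop
  simp only [roundOps, blk, List.mem_append] at hop
  have hb := PhaseQuery.lt_map_cl (fun op hop w hw => lt_of_lt_of_le (blkC_lt_Wblk P n op hop w hw) (Wblk_le_NW P n))
  rcases hop with ((h | h) | h) | h
  · exact hb op h
  · exact PhaseQuery.lt_map_cl (copyC_lt P n ht) op h
  · exact hb op h
  · exact orcT_lt P n ht op h

/-- A round is classical-or-query. [folklore] -/
theorem isCl_roundOps (t : ℕ) : ∀ op ∈ roundOps P n t, OSim.IsCl op := by
  intro op hop
  simp only [roundOps, blk, List.mem_append] at hop
  rcases hop with ((h | h) | h) | h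
  · exact isCl_map_cl op h
  · exact isCl_map_cl op h
  · exact isCl_map_cl op h
  · exact isCl_orcT P n t op h

/-- Members of `rounds`. [folklore] -/
theorem mem_rounds {op : RtOp ℕ} : op ∈ rounds P n ↔ ∃ t < RR P n, op ∈ roundOps P n t := by
  simp [rounds]

/-- Members of `swapPairs`. [folklore] -/
theorem mem_swapPairs {p : ℕ × ℕ} : p ∈ swapPairs P n ↔ ∃ j < JF P n, p = (j, fW P n (RR P n * RR P n + j)) := by
  simp [swapPairs, eq_comm]

/-- The swaps are well formed. [folklore] -/
theorem swapsC_wf : ∀ op ∈ swapsC P n, op.WF := by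
  refine RevMux.swapOps_wf fun p hp => ?_
  obtain ⟨j, hj, rfl⟩ := (mem_swapPairs P n).1 hp
  exact Nat.ne_of_lt (lt_fW_of_lt_JF P n hj _)

/-- The swaps stay inside the block. [folklore] -/
theorem swapsC_lt_Wblk : ∀ op ∈ swapsC P n, ∀ w ∈ wiresOf op, w < Wblk P n := by
  intro op hop w hw
  obtain ⟨p, hp, h⟩ := RevMux.mem_swapOps hop
  obtain ⟨j, hj, rfl⟩ := (mem_swapPairs P n).1 hp
  have hf := fW_lt_Wblk P n (out_lt_JJ P n hj)
  have hj' := lt_trans (lt_fW_of_lt_JF P n hj (RR P n * RR P n + j)) hf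
  rcases h with rfl | rfl <;>
    simp only [wiresOf, ClOp.target, ClOp.controls, List.mem_cons, List.not_mem_nil, or_false] at hw <;>
    rcases hw with rfl | rfl <;> assumption

/-- The finale is well formed. [folklore] -/
theorem fin_wf : ∀ op ∈ fin P n, op.WF := by
  intro op hop
  simp only [fin, blk, List.mem_append] at hop
  rcases hop with h | h
  · exact PhaseQuery.wf_map_cl (blkC_wf P n) op h
  · exact PhaseQuery.wf_map_cl (swapsC_wf P n) op h

/-- The finale stays inside the block. [folklore] -/
theorem fin_lt_Wblk : ∀ op ∈ fin P n, ∀ w ∈ op.wires, w < Wblk P n := by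
  intro op hop
  simp only [fin, blk, List.mem_append] at hop
  rcases hop with h | h
  · exact PhaseQuery.lt_map_cl (blkC_lt_Wblk P n) op h
  · exact PhaseQuery.lt_map_cl (swapsC_lt_Wblk P n) op h

/-- The finale is classical. [folklore] -/
theorem isCl_fin : ∀ op ∈ fin P n, OSim.IsCl op := by
  intro op hop
  simp only [fin, blk, List.mem_append] at hop
  rcases hop with h | h
  · exact isCl_map_cl op h
  · exact isCl_map_cl op h

/-- **The classical part is well formed.** [folklore] -/
theorem body_wf : ∀ op ∈ body P n, op.WF := by
  intro op hop
  simp only [body, List.mem_append] at hop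
  rcases hop with h | h
  · obtain ⟨t, ht, h⟩ := (mem_rounds P n).1 h
    exact roundOps_wf P n ht op h
  · exact fin_wf P n op h

/-- **The classical part stays inside the register.** [folklore] -/
theorem body_lt : ∀ op ∈ body P n, ∀ w ∈ op.wires, w < NW P n := by
  intro op hop
  simp only [body, List.mem_append] at hop
  rcases hop with h | h
  · obtain ⟨t, ht, h⟩ := (mem_rounds P n).1 h
    exact roundOps_lt P n ht op h
  · exact fun w hw => lt_of_lt_of_le (fin_lt_Wblk P n op h w hw) (Wblk_le_NW P n)

/-- **The classical part is classical-or-query.** [folklore] -/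
theorem isCl_body : ∀ op ∈ body P n, OSim.IsCl op := by
  intro op hop
  simp only [body, List.mem_append] at hop
  rcases hop with h | h
  · obtain ⟨t, -, h⟩ := (mem_rounds P n).1 h
    exact isCl_roundOps P n t op h
  · exact isCl_fin P n op h

/-- The Hadamard operations are well formed. [folklore] -/
theorem hadOps_wf : ∀ op ∈ hadOps P n, op.WF := by
  intro op hop
  simp only [hadOps, List.mem_map, List.mem_range] at hop
  obtain ⟨j, -, rfl⟩ := hop
  trivial

/-- The Hadamard operations sit on the coin wires. [folklore] -/
theorem hadOps_lt : ∀ op ∈ hadOps P n, ∀ w ∈ op.wires, w < NW P n := by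
  intro op hop w hw
  simp only [hadOps, List.mem_map, List.mem_range] at hop
  obtain ⟨j, hj, rfl⟩ := hop
  simp only [RtOp.wires, List.mem_singleton] at hw
  subst hw
  dsimp only [NW]; omega

end Bounds

/-! ### The circuit and the family -/

section Family

variable (n : ℕ)

/-- The wire embedding `ℕ → Fin NW` (identity below `NW`). [folklore] -/
def foW : ℕ → Fin (NW P n) := finOf (NW P n) (NW_pos P n)

/-- The classical part re-indexed to `Fin NW`. [folklore] -/
def bodyF : List (RtOp (Fin (NW P n))) := (body P n).map (RtOp.map (foW P n))

/-- The re-indexed classical part is well formed. [folklore] -/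
theorem bodyF_wf : ∀ op ∈ bodyF P n, op.WF := wf_map_finOf_of (NW_pos P n) (body_wf P n) (body_lt P n)

/-- **The classical part of the circuit at input length `n`**: the compilation of `body`.
[cite: BernsteinVazirani1997SICOMP, Thm. 8.3 (proof) with §8.3] -/
def Dc : QCircuit cliffordT (n + (P.q.eval n + mW P n)) := ⟨RtOp.compileList (bodyF P n) (bodyF_wf P n)⟩

/-- **The simulating coin family**: Hadamard on each coin wire, then `Dc n`.
[cite: BernsteinVazirani1997SICOMP, Thm. 8.3 (proof) with §8.3] -/
abbrev family : QCircuitFamily cliffordT := coinFamily (fun n => P.q.eval n) (mW P) (Dc P)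

/-- **The classical part acts classically on basis states, relative to the oracle**: it maps `|w⟩`
to `|ocEval A body (liftW w)⟩` (`OSim.compileList_map_mulVec_basisState`). [cite: BernsteinVazirani1997SICOMP, Thm. 8.3 (proof) and §8.3] -/
theorem Dc_mulVec_basisState (A : Language Bool) (w : QReg (NW P n)) :
    (Dc P n).toMatrix A *ᵥ basisState w = basisState fun p => OSim.ocEval A (body P n) (liftW w) p :=
  OSim.compileList_map_mulVec_basisState A (NW_pos P n) (body P n) (isCl_body P n) (body_lt P n) _ w

end Family

end OCoin

end Literature.Computability.QuantumComplexity

end
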